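import Mathlib
import Summits.ValiantsHypothesis.ValiantsHypothesis.Theorems.BarrierLeverPartitionMinorsHitByVPHiddenStatesTiltMoebius

/-!
# Route BarrierLever — item `PartitionMinorsHitByVP` (stmt-ValiantsHypothesis-19717), line `hidden-states`:
# TILTED CUBES II — THE TILT TABLE and its hidden points

Helper file (`--supports stmt-ValiantsHypothesis-19717`; cell valiant-natproofs, rung V4, 𝒟-side door (c), registered line
`Cruxes/PartitionMinorsHitByVP/Lines/hidden_states.lean` v7; prover seat val-np-p6 gen 12). Definition-free; closes NO item.

Coordinates `Fin (d+2)`: cube coordinates `i < d` (`Fin.castAdd 2 i`), the TILT coordinate `y₀ = d`, the CORE coordinate `x₀ = d+1`.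
`exists_tiltTable`: an explicit table on two pieces `p₀ ≠ p₁` whose hidden points are — for a `p₀`-column with state set `J`
(states `< d+1`): the 0/1 point `(1_{J<d}; [d ∈ J]; [d ∈ J])` (the core coordinate DUPLICATES the tilt coordinate), and for a
`p₁`-column with state set `J` (states `< d`): the point `(1_J; |J|; |J| + 1)` — off the hyperplane `x₀ = y₀`. The sequel
`…TiltCore` proves that against every row family containing `B_d ∪ {univ ∖ x₀}` these columns are linearly independent.
`sum_mul_apply_eq_sum_fiber` is fibrewise bookkeeping.

WHAT THIS IS NOT: a table; nothing on crux 14610 or VP ≠ VNP.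
-/

set_option linter.dupNamespace false

namespace Summit.ValiantsHypothesis.ValiantsHypothesis.Theorems.BarrierLever.HiddenStates

open Finset

noncomputable section

namespace Tilt

/-- Fibrewise rewriting of a weighted column sum. -/
theorem sum_mul_apply_eq_sum_fiber {ι β : Type*} [Fintype β] [DecidableEq β] (C : Finset ι) (f : ι → β) (α : ι → ℂ)
    (F : β → ℂ) : ∑ k ∈ C, α k * F (f k) = ∑ b, (∑ k ∈ C.filter (fun k => f k = b), α k) * F b := by
  classical
  rw [← Finset.sum_fiberwise_of_maps_to (s := C) (t := Finset.univ) (g := f) (fun k _ => Finset.mem_univ (f k))]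
  refine Finset.sum_congr rfl fun b _ => ?_
  rw [Finset.sum_mul]
  refine Finset.sum_congr rfl fun k hk => ?_
  rw [(Finset.mem_filter.mp hk).2]

/-- **THE TILT TABLE.** See the module docstring: hidden points `(1_{J<d}; [d∈J]; [d∈J])` on `p₀` and `(1_J; |J|; |J|+1)` on `p₁`. -/
theorem exists_tiltTable (d m K : ℕ) (hK : d + 1 ≤ K) (p₀ p₁ : Fin m) (hp : p₀ ≠ p₁) :
    ∃ tx₀ : Fin m → Option (Fin K) → Fin (d + 2) → ℂ,
      (∀ J : Finset (Fin K), (∀ q ∈ J, (q : ℕ) < d + 1) →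
        (∀ i : Fin d, tx₀ p₀ none (Fin.castAdd 2 i) + ∑ q ∈ J, tx₀ p₀ (some q) (Fin.castAdd 2 i)
            = if (⟨i, by omega⟩ : Fin K) ∈ J then 1 else 0) ∧
        (tx₀ p₀ none ⟨d, by omega⟩ + ∑ q ∈ J, tx₀ p₀ (some q) ⟨d, by omega⟩ = if (⟨d, by omega⟩ : Fin K) ∈ J then 1 else 0) ∧
        (tx₀ p₀ none ⟨d + 1, by omega⟩ + ∑ q ∈ J, tx₀ p₀ (some q) ⟨d + 1, by omega⟩
            = if (⟨d, by omega⟩ : Fin K) ∈ J then 1 else 0)) ∧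
      (∀ J : Finset (Fin K), (∀ q ∈ J, (q : ℕ) < d) →
        (∀ i : Fin d, tx₀ p₁ none (Fin.castAdd 2 i) + ∑ q ∈ J, tx₀ p₁ (some q) (Fin.castAdd 2 i)
            = if (⟨i, by omega⟩ : Fin K) ∈ J then 1 else 0) ∧
        (tx₀ p₁ none ⟨d, by omega⟩ + ∑ q ∈ J, tx₀ p₁ (some q) ⟨d, by omega⟩ = (J.card : ℂ)) ∧
        (tx₀ p₁ none ⟨d + 1, by omega⟩ + ∑ q ∈ J, tx₀ p₁ (some q) ⟨d + 1, by omega⟩ = (J.card : ℂ) + 1)) := by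
  classical
  let cc : Fin d ↪ Fin (d + 2) := Fin.castAddEmb 2
  let y₀ : Fin (d + 2) := ⟨d, by omega⟩
  let x₀ : Fin (d + 2) := ⟨d + 1, by omega⟩
  have hccv : ∀ i : Fin d, ((cc i : Fin (d + 2)) : ℕ) = i := fun i => rfl
  let st : Fin d → Fin K := fun i => ⟨i, by omega⟩
  let sd : Fin K := ⟨d, by omega⟩
  let tx₀ : Fin m → Option (Fin K) → Fin (d + 2) → ℂ := fun p o a =>
    if p = p₀ then
      (match o with
        | none => 0
        | some q => (if (a : ℕ) = q then 1 else 0) + (if (q : ℕ) = d ∧ (a : ℕ) = d + 1 then 1 else 0))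
    else if p = p₁ then
      (match o with
        | none => if (a : ℕ) = d + 1 then 1 else 0
        | some q => (if (a : ℕ) = q then 1 else 0) + (if (a : ℕ) = d then 1 else 0) + (if (a : ℕ) = d + 1 then 1 else 0))
    else 0
  refine ⟨tx₀, ?_, ?_⟩
  · intro J hJ
    let pt : Fin (d + 2) → ℂ := fun a => tx₀ p₀ none a + ∑ q ∈ J, tx₀ p₀ (some q) a
    show (∀ i : Fin d, pt (cc i) = _) ∧ pt y₀ = _ ∧ pt x₀ = _
    -- indicator sums over a state set
    have hind_sum : ∀ (J : Finset (Fin K)) (q₀ : Fin K),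
        ∑ q ∈ J, (if (q : ℕ) = (q₀ : ℕ) then (1 : ℂ) else 0) = if q₀ ∈ J then 1 else 0 := by
      intro J q₀
      have : ∀ q ∈ J, (if (q : ℕ) = (q₀ : ℕ) then (1 : ℂ) else 0) = if q = q₀ then 1 else 0 := fun q _ => by
        simp only [Fin.ext_iff]
      rw [Finset.sum_congr rfl this, Finset.sum_ite_eq' J q₀]
    -- piece p₀ (explicit table equations first)
    have htx0n : ∀ a : Fin (d + 2), tx₀ p₀ none a = 0 := fun a => by simp only [tx₀, if_true]
    have htx0s : ∀ (q : Fin K) (a : Fin (d + 2)), tx₀ p₀ (some q) a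
        = (if (a : ℕ) = (q : ℕ) then 1 else 0) + (if (q : ℕ) = d ∧ (a : ℕ) = d + 1 then 1 else 0) := fun q a => by
      simp only [tx₀, if_true]
    have hpt0 : ∀ a : Fin (d + 2), pt a
        = ∑ q ∈ J, ((if (a : ℕ) = (q : ℕ) then 1 else 0) + (if (q : ℕ) = d ∧ (a : ℕ) = d + 1 then 1 else 0)) := by
      intro a
      simp only [pt, htx0n, htx0s, zero_add]
    have hpt0c : ∀ i : Fin d, pt (cc i) = if st i ∈ J then 1 else 0 := by
      intro i
      rw [hpt0]
      have : ∀ q ∈ J, ((if ((cc i : Fin (d + 2)) : ℕ) = (q : ℕ) then (1 : ℂ) else 0)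
          + (if (q : ℕ) = d ∧ ((cc i : Fin (d + 2)) : ℕ) = d + 1 then 1 else 0)) = if (q : ℕ) = ((st i : Fin K) : ℕ) then 1 else 0 := by
        intro q _
        have h2 : ¬ ((q : ℕ) = d ∧ ((cc i : Fin (d + 2)) : ℕ) = d + 1) := fun h' => by rw [hccv] at h'; omega
        rw [if_neg h2, add_zero, hccv]
        simp only [st, eq_comm]
      rw [Finset.sum_congr rfl this, hind_sum]
    have hpt0y : pt y₀ = if sd ∈ J then 1 else 0 := by
      rw [hpt0]
      have hy : ((y₀ : Fin (d + 2)) : ℕ) = d := rfl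
      have : ∀ q ∈ J, ((if ((y₀ : Fin (d+2)) : ℕ) = (q : ℕ) then (1 : ℂ) else 0)
          + (if (q : ℕ) = d ∧ ((y₀ : Fin (d+2)) : ℕ) = d + 1 then 1 else 0)) = if (q : ℕ) = ((sd : Fin K) : ℕ) then 1 else 0 := by
        intro q _
        have h2 : ¬ ((q : ℕ) = d ∧ ((y₀ : Fin (d+2)) : ℕ) = d + 1) := fun h' => by rw [hy] at h'; omega
        rw [if_neg h2, add_zero, hy]
        simp only [eq_comm]
      rw [Finset.sum_congr rfl this, hind_sum]
    have hpt0x : pt x₀ = if sd ∈ J then 1 else 0 := by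
      rw [hpt0]
      have hx : ((x₀ : Fin (d + 2)) : ℕ) = d + 1 := rfl
      have : ∀ q ∈ J, ((if ((x₀ : Fin (d+2)) : ℕ) = (q : ℕ) then (1 : ℂ) else 0)
          + (if (q : ℕ) = d ∧ ((x₀ : Fin (d+2)) : ℕ) = d + 1 then 1 else 0)) = if (q : ℕ) = ((sd : Fin K) : ℕ) then 1 else 0 := by
        intro q hq
        have hq' := hJ q hq
        have h1 : ¬ (((x₀ : Fin (d+2)) : ℕ) = (q : ℕ)) := by rw [hx]; omega
        rw [if_neg h1, zero_add, hx]
        simp only [sd, and_true]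
      rw [Finset.sum_congr rfl this, hind_sum]
    exact ⟨hpt0c, hpt0y, hpt0x⟩
  · intro J hJ
    let pt : Fin (d + 2) → ℂ := fun a => tx₀ p₁ none a + ∑ q ∈ J, tx₀ p₁ (some q) a
    show (∀ i : Fin d, pt (cc i) = _) ∧ pt y₀ = _ ∧ pt x₀ = _
    -- indicator sums over a state set
    have hind_sum : ∀ (J : Finset (Fin K)) (q₀ : Fin K),
        ∑ q ∈ J, (if (q : ℕ) = (q₀ : ℕ) then (1 : ℂ) else 0) = if q₀ ∈ J then 1 else 0 := by
      intro J q₀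
      have : ∀ q ∈ J, (if (q : ℕ) = (q₀ : ℕ) then (1 : ℂ) else 0) = if q = q₀ then 1 else 0 := fun q _ => by
        simp only [Fin.ext_iff]
      rw [Finset.sum_congr rfl this, Finset.sum_ite_eq' J q₀]
    -- piece p₁ (explicit table equations first, so that no `if` is evaluated prematurely)
    have htx1n : ∀ a : Fin (d + 2), tx₀ p₁ none a = if (a : ℕ) = d + 1 then 1 else 0 := fun a => by
      simp only [tx₀, hp.symm, if_false, if_true]
    have htx1s : ∀ (q : Fin K) (a : Fin (d + 2)), tx₀ p₁ (some q) a
        = (if (a : ℕ) = (q : ℕ) then 1 else 0) + (if (a : ℕ) = d then 1 else 0) + (if (a : ℕ) = d + 1 then 1 else 0) := fun q a => by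
      simp only [tx₀, hp.symm, if_false, if_true]
    have hpt1 : ∀ a : Fin (d + 2), pt a = (if (a : ℕ) = d + 1 then 1 else 0)
        + ∑ q ∈ J, ((if (a : ℕ) = (q : ℕ) then 1 else 0) + (if (a : ℕ) = d then 1 else 0) + (if (a : ℕ) = d + 1 then 1 else 0)) := by
      intro a
      simp only [pt, htx1n, htx1s]
    have hpt1c : ∀ i : Fin d, pt (cc i) = if st i ∈ J then 1 else 0 := by
      intro i
      have h0 : ¬ (((cc i : Fin (d + 2)) : ℕ) = d + 1) := by rw [hccv]; omega
      have h0' : ¬ (((cc i : Fin (d + 2)) : ℕ) = d) := by rw [hccv]; omega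
      rw [hpt1, if_neg h0, if_neg h0']
      simp only [add_zero, zero_add]
      have : ∀ q ∈ J, (if ((cc i : Fin (d + 2)) : ℕ) = (q : ℕ) then (1 : ℂ) else 0)
          = if (q : ℕ) = ((st i : Fin K) : ℕ) then 1 else 0 := by
        intro q _
        rw [hccv]
        simp only [st, eq_comm]
      rw [Finset.sum_congr rfl this, hind_sum]
    have hpt1y : pt y₀ = (J.card : ℂ) := by
      have hy : ((y₀ : Fin (d + 2)) : ℕ) = d := rfl
      have h0 : ¬ (((y₀ : Fin (d+2)) : ℕ) = d + 1) := by rw [hy]; omega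
      rw [hpt1, if_neg h0, if_pos hy]
      simp only [add_zero, zero_add]
      have : ∀ q ∈ J, ((if ((y₀ : Fin (d+2)) : ℕ) = (q : ℕ) then (1 : ℂ) else 0) + 1) = 1 := by
        intro q hq
        have hq' := hJ q hq
        have h1 : ¬ (((y₀ : Fin (d+2)) : ℕ) = (q : ℕ)) := by rw [hy]; omega
        rw [if_neg h1]; ring
      rw [Finset.sum_congr rfl this, Finset.sum_const, nsmul_eq_mul, mul_one]
    have hpt1x : pt x₀ = (J.card : ℂ) + 1 := by
      have hx : ((x₀ : Fin (d + 2)) : ℕ) = d + 1 := rfl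
      have h2 : ¬ (((x₀ : Fin (d+2)) : ℕ) = d) := by rw [hx]; omega
      rw [hpt1, if_pos hx, if_neg h2]
      simp only [add_zero]
      have : ∀ q ∈ J, ((if ((x₀ : Fin (d+2)) : ℕ) = (q : ℕ) then (1 : ℂ) else 0) + 1) = 1 := by
        intro q hq
        have hq' := hJ q hq
        have h1 : ¬ (((x₀ : Fin (d+2)) : ℕ) = (q : ℕ)) := by rw [hx]; omega
        rw [if_neg h1]; ring
      rw [Finset.sum_congr rfl this, Finset.sum_const, nsmul_eq_mul, mul_one, add_comm]
    exact ⟨hpt1c, hpt1y, hpt1x⟩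

/-- Two state sets inside the block `< d + 1` with the same low part and the same `d`-bit coincide. -/
theorem stateSet_ext {d K : ℕ} (hK : d + 1 ≤ K) (J J' : Finset (Fin K)) (hJ : ∀ q ∈ J, (q : ℕ) < d + 1)
    (hJ' : ∀ q ∈ J', (q : ℕ) < d + 1)
    (hlow : ∀ i : Fin d, (⟨i, by omega⟩ : Fin K) ∈ J ↔ (⟨i, by omega⟩ : Fin K) ∈ J')
    (hsd : (⟨d, by omega⟩ : Fin K) ∈ J ↔ (⟨d, by omega⟩ : Fin K) ∈ J') : J = J' := by
  ext q
  by_cases hq : (q : ℕ) < d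
  · have := hlow ⟨q, hq⟩
    have hq' : (⟨((⟨q, hq⟩ : Fin d) : ℕ), by omega⟩ : Fin K) = q := Fin.ext rfl
    rwa [hq'] at this
  · by_cases hqd : (q : ℕ) = d
    · have hq' : (⟨d, by omega⟩ : Fin K) = q := Fin.ext (by simp [hqd])
      rwa [hq'] at hsd
    · constructor
      · intro h; have := hJ q h; omega
      · intro h; have := hJ' q h; omega

end Tilt

end

end Summit.ValiantsHypothesis.ValiantsHypothesis.Theorems.BarrierLever.HiddenStates
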